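import Mathlib
import Summits.Ventures.PercRepro2.HCov
import Summits.Ventures.PercRepro2.BHKOutside
import Summits.Ventures.PercRepro2.ISplit
import Summits.Ventures.PercRepro2.FirstOrderTerms
import Summits.Ventures.PercRepro2.CovFourTerm
import Summits.Ventures.PercRepro2.FirstOrderSlope

/-!
# The first half `(K1)` of the pendant-root condition `(K)` follows from `Cc ≥ 0`, `Cfo ≥ 0`, Harris and
ONE candidate inequality `P(b ∈ C₂ | T) ≥ P(b ∈ C₂ | PD)` (blind cell PercRepro2, p5 g22;
`proofs/P5-OEDGE.md` §28 (4), `S4-HARDSTEP.md` v94 §2.4 (p))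

For an instance `(o, a₁, a₂, a₃, b)` write `m_PD = P(PD, b ∈ C₂)`, `m_T = P(T, b ∈ C₂)`,
`ℓ_PD = P(PD, o ∈ C₁, b ∈ C₂)`, `ℓ_T = P(T, o ∈ C₁, b ∈ C₂)`, `D = P(PD)`, `t = P(T)`, `D_o = P(PD, o ∈ U)`,
`Q = P(a₁ ↮ a₂)`, `D₀ = P(a₃ ∉ C₁)`, `D_o⁰ = P(a₃ ∉ C₁, o ∈ C₁)`.  The condition `(K)` of §27 addendum 3
(`2′PROOT ⟸ (HCOV) ∧ (K)`) splits as `(K) = (K1) + (K2)` with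

  `(K1)`: `D · C(γ) ≥ Q · D₀ · (γ − γ₀) · m_PD`, cleared: **`D · Cc ≥ Q · (D₀ · D_o − D · D_o⁰) · m_PD`**

(`Cc = D·C(γ) = FourTerm.Cc`, census 83/83, climb never below `+4.5·10⁻¹³`).  **`K1_of_T_dominates_PD`**:
`(K1)` holds as soon as `t · m_PD ≤ D · m_T` (**`P(b ∈ C₂ | T) ≥ P(b ∈ C₂ | PD)`**, the candidate of
§28 (4): 90/90, four climbs best `0.0`), by the exact identity

  `m_R · [D·Cc − Q(D₀D_o − D D_o⁰) m_PD] = Cc·(D m_T − t m_PD) + Cc·m_PD·(D + t − Q D₀) + Q·m_PD·D·Cfo′`,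

`m_R = m_PD + m_T`, `Cfo′ = D_o⁰ m_R − D₀ (ℓ_PD + ℓ_T) = Cfo` at `z = a₂` (BHK 1.4), `D + t − Q D₀ ≥ 0`
(Harris on the two decreasing events `Q`, `{a₃ ∉ C₁}`), `Cc ≥ 0` (`Cc_nonneg`).  The proof is the ratio argument
`D·C(γ) = D(γ − x)(m_PD + m_T) ≥ (D + t)(γ − x) m_PD ≥ Q D₀ (γ − x) m_PD ≥ Q D₀ (γ − γ₀) m_PD`,
`x = P(o ∈ C₁ | PD ∪ T, b ∈ C₂) ≤ γ₀` (Cfo), `≤ γ` (Cc), cleared of its denominators.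
-/

namespace Summit.Ventures.PercRepro2

open UnionCluster

namespace CovForm

namespace FirstOrder

section Main

variable {V : Type*} {E : Type*} [Fintype E] [DecidableEq E] [Fintype V] [DecidableEq V]
  {R : Type*} [Field R] [LinearOrder R] [IsStrictOrderedRing R]

omit [Fintype E] [DecidableEq E] [Fintype V] in
/-- `{a₂ ↮ a₁} ∩ {a₁ ↮ a₃} = {a₁ ↮ a₂, a₃}`. -/
lemma avoid_inter_avoid_eq (ends : E → Sym2 V) (a₁ a₂ a₃ : V) :
    avoidAll ends a₂ {a₁} ∩ avoidAll ends a₁ {a₃} = avoidAll ends a₁ {a₂, a₃} := by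
  ext ω
  simp only [Set.mem_inter_iff, mem_avoidAll, Finset.mem_singleton, forall_eq, Finset.mem_insert,
    forall_eq_or_imp]
  exact ⟨fun ⟨h21, h13⟩ => ⟨fun h12 => h21 (conn_symm h12), h13⟩,
    fun ⟨h12, h13⟩ => ⟨fun h21 => h12 (conn_symm h21), h13⟩⟩

omit [Fintype V] in
/-- **Harris, in the `PD + T` form**: `P(Q) · D₀ ≤ P(PD) + P(T)`. -/
theorem Q_mul_D0_le_PD_add_T (p : E → R) (hp : IsProbVec p) (ends : E → Sym2 V) (a₁ a₂ a₃ : V) :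
    prob p (avoidAll ends a₂ {a₁}) * D0 p ends a₁ a₃ ≤
      prob p (PDEvent ends a₁ a₂ a₃) + prob p (TEvent ends a₁ a₂ a₃) := by
  have hlow : ∀ s x : V, IsLowerSet (avoidAll ends s {x}) := by
    intro s x ω ω' h hω y hy hc
    exact hω y hy (conn_mono h hc)
  have h : prob p (avoidAll ends a₂ {a₁}) * D0 p ends a₁ a₃ ≤
      prob p (avoidAll ends a₂ {a₁} ∩ avoidAll ends a₁ {a₃}) := by
    unfold D0
    exact prob_mul_prob_le_prob_inter_of_isLowerSet hp (hlow a₂ a₁) (hlow a₁ a₃)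
  have hR := ISplit.prob_PD_add_T p ends a₁ a₂ a₃ Set.univ
  simp only [Set.inter_univ] at hR
  rw [avoid_inter_avoid_eq] at h
  linarith

/-- **`Cfo` at `z = a₂` in the `PD + T` form**:
`D₀ · (ℓ_PD + ℓ_T) ≤ D_o⁰ · (m_PD + m_T)` — BHK06 Thm 1.4 (`Cfo_nonneg`). -/
theorem Cfo_PD_add_T (p : E → R) (hp : IsProbVec p) (ends : E → Sym2 V) (o a₁ a₂ a₃ b : V) :
    D0 p ends a₁ a₃ *
        (prob p (PDEvent ends a₁ a₂ a₃ ∩ (connEvent ends a₁ o ∩ connEvent ends a₂ b)) +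
          prob p (TEvent ends a₁ a₂ a₃ ∩ (connEvent ends a₁ o ∩ connEvent ends a₂ b))) ≤
      Do0 p ends o a₁ a₃ *
        (prob p (PDEvent ends a₁ a₂ a₃ ∩ connEvent ends a₂ b) +
          prob p (TEvent ends a₁ a₂ a₃ ∩ connEvent ends a₂ b)) := by
  have h := Cfo_nonneg p hp ends o a₁ a₃ b a₂
  unfold Cfo at h
  have hb := ISplit.prob_PD_add_T p ends a₁ a₂ a₃ (connEvent ends a₂ b)
  have hob := ISplit.prob_PD_add_T p ends a₁ a₂ a₃ (connEvent ends a₁ o ∩ connEvent ends a₂ b)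
  have e : avoidAll ends a₁ {a₂, a₃} ∩ connEvent ends a₂ b ∩ connEvent ends a₁ o =
      avoidAll ends a₁ {a₂, a₃} ∩ (connEvent ends a₁ o ∩ connEvent ends a₂ b) := by
    ext ω; simp only [Set.mem_inter_iff]; tauto
  rw [e, ← hob, ← hb] at h
  linarith

/-- **`(K1)` from the domination `P(b ∈ C₂ | T) ≥ P(b ∈ C₂ | PD)`** (hypothesis `hI : t·m_PD ≤ D·m_T`):
`D · Cc ≥ Q · (D₀ · D_o − D · D_o⁰) · m_PD`, i.e. `D · C(γ) ≥ Q · D₀ · (γ − γ₀) · P(PD, b ∈ C₂)`. -/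
theorem K1_of_T_dominates_PD (p : E → R) (hp : IsProbVec p) (ends : E → Sym2 V) (o a₁ a₂ a₃ b : V)
    (hI : prob p (TEvent ends a₁ a₂ a₃) * prob p (PDEvent ends a₁ a₂ a₃ ∩ connEvent ends a₂ b) ≤
      prob p (PDEvent ends a₁ a₂ a₃) * prob p (TEvent ends a₁ a₂ a₃ ∩ connEvent ends a₂ b)) :
    prob p (avoidAll ends a₂ {a₁}) *
        (D0 p ends a₁ a₃ * Do p ends o a₁ a₂ a₃ - prob p (PDEvent ends a₁ a₂ a₃) * Do0 p ends o a₁ a₃) *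
        prob p (PDEvent ends a₁ a₂ a₃ ∩ connEvent ends a₂ b) ≤
      prob p (PDEvent ends a₁ a₂ a₃) * FourTerm.Cc p ends o a₁ a₂ a₃ b := by
  have hA := FourTerm.Cc_nonneg p hp ends o a₁ a₂ a₃ b
  have hB := Cfo_PD_add_T p hp ends o a₁ a₂ a₃ b
  have hH := Q_mul_D0_le_PD_add_T p hp ends a₁ a₂ a₃
  -- names
  set A := FourTerm.Cc p ends o a₁ a₂ a₃ b with hAdef
  set D := prob p (PDEvent ends a₁ a₂ a₃) with hD
  set t := prob p (TEvent ends a₁ a₂ a₃) with ht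
  set Q := prob p (avoidAll ends a₂ {a₁}) with hQ
  set Dd := D0 p ends a₁ a₃ with hDd
  set Do1 := Do p ends o a₁ a₂ a₃ with hDo1
  set Doo := Do0 p ends o a₁ a₃ with hDoo
  set mPD := prob p (PDEvent ends a₁ a₂ a₃ ∩ connEvent ends a₂ b) with hmPD
  set mT := prob p (TEvent ends a₁ a₂ a₃ ∩ connEvent ends a₂ b) with hmT
  set lPD := prob p (PDEvent ends a₁ a₂ a₃ ∩ (connEvent ends a₁ o ∩ connEvent ends a₂ b)) with hlPD
  set lT := prob p (TEvent ends a₁ a₂ a₃ ∩ (connEvent ends a₁ o ∩ connEvent ends a₂ b)) with hlT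
  have hAeq : A = Do1 * (mPD + mT) - D * (lPD + lT) := by
    rw [hAdef]; unfold FourTerm.Cc; rfl
  have hD0 : 0 ≤ D := prob_nonneg hp _
  have hQ0 : 0 ≤ Q := prob_nonneg hp _
  have hmPD0 : 0 ≤ mPD := prob_nonneg hp _
  have hmT0 : 0 ≤ mT := prob_nonneg hp _
  -- the three nonnegative products
  have hI' : 0 ≤ D * mT - t * mPD := by linarith
  have hH' : 0 ≤ D + t - Q * Dd := by linarith
  have hB' : 0 ≤ Doo * (mPD + mT) - Dd * (lPD + lT) := by linarith
  have key : (mPD + mT) * (D * A - Q * (Dd * Do1 - D * Doo) * mPD) =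
      A * (D * mT - t * mPD) + A * mPD * (D + t - Q * Dd) +
        Q * mPD * D * (Doo * (mPD + mT) - Dd * (lPD + lT)) := by
    rw [hAeq]; ring
  have hsum : 0 ≤ A * (D * mT - t * mPD) + A * mPD * (D + t - Q * Dd) +
      Q * mPD * D * (Doo * (mPD + mT) - Dd * (lPD + lT)) := by
    have h1 := mul_nonneg hA hI'
    have h2 := mul_nonneg (mul_nonneg hA hmPD0) hH'
    have h3 := mul_nonneg (mul_nonneg (mul_nonneg hQ0 hmPD0) hD0) hB'
    linarith
  rw [← key] at hsum
  rcases eq_or_lt_of_le (add_nonneg hmPD0 hmT0) with hz | hpos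
  · -- `m_PD + m_T = 0`: then `m_PD = 0` and the target is `0 ≤ D · A`
    have hmPDz : mPD = 0 := by linarith
    rw [hmPDz, mul_zero]
    exact mul_nonneg hD0 hA
  · have := nonneg_of_mul_nonneg_right hsum hpos
    -- `nonneg_of_mul_nonneg_right : 0 ≤ a * b → 0 < a → 0 ≤ b`
    linarith

end Main

end FirstOrder

end CovForm

end Summit.Ventures.PercRepro2
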